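import Summits.AtomisticToContinuum.BoseEinsteinCondensation.Theorems.BECInfDivCoherenceGridInfDivCoherenceCoherencePosDef
import Summits.AtomisticToContinuum.BoseEinsteinCondensation.Theorems.BECInfDivCoherenceGridInfDivCoherenceGridCharacterSum
import Summits.AtomisticToContinuum.BoseEinsteinCondensation.Theorems.BECInfDivCoherenceGridInfDivCoherenceCohGridEven
import Summits.AtomisticToContinuum.BoseEinsteinCondensation.Theorems.BECInfDivCoherenceGridInfDivCoherenceCosInversion
import Summits.AtomisticToContinuum.BoseEinsteinCondensation.Theorems.BECInfDivCoherenceGridInfDivCoherenceExpPosComb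
import Summits.AtomisticToContinuum.BoseEinsteinCondensation.Theorems.BECInfDivCoherenceLevyMassCondensationGrid
import HarnessLib

/-!
# Route `BECInfDivCoherence`, crux `GridInfDivCoherence` (stmt-AtomisticToContinuum-9114): the negative
# Lévy mass of a half-condensed coherence is controlled by the discrete f-sum

Support file (`--supports stmt-AtomisticToContinuum-9114`; lead c2). The glue `LevyMassCondensation`
(stmt-9117) consumes the crux (`ν_q ≥ −ε` off `q = 0`) only through the `λ`-weighted NEGATIVE Lévy mass
`Σ_{q≠0} ν_q⁻ λ_q`, `λ_q = Σ_a (1 − cos(2π q_a/m))` (`levyMass_le`). Here that quantity is bounded by the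
f-sum of the coherence itself, with NO sign hypothesis, once the zero mode carries more than half the mass:
`negLevy_fsum_le` (pure, on `(ℤ/m)³`: `G` even, Bochner-positive, `G(0) = 1`, `g₀ = m⁻³Σ_j G(j) > 1/2` ⇒
`G > 0` and `Σ_{q≠0} ν_q⁻ λ_q ≤ ((1−g₀)/(2g₀−1)) Σ_a ((1−G(e_a)) + (1−G(−e_a)))/2`; proof: `G = g₀(1+u)`,
`u` a non-negative cosine combination with `|u| ≤ (1−g₀)/g₀ < 1`, `log(1+u) = artanh u − (−½log(1−u²))`
with BOTH parts positive definite by Schur powers + the Mathlib log series, so `ν⁻ ≤` the transform of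
`B(u) = −½log(1−u²)`, whose `λ`-moment is `Σ_a (B(u(0)) − B(u(±e_a)))` (`levyWeight_fsum`) and
`B(x) − B(y) ≤ x(x−y)/(1−x²)`), and `negLevyMoment_coherence_le` (crux vocabulary: Bochner positivity
`sum_re_cos_coherence_grid_nonneg`, `stub_cohGridEven`, `coh_zero`, then `one_sub_coh_le`):
`Σ_{q≠0} ν_q⁻ λ_q ≤ ((1−g₀)/(2g₀−1)) (h²/2) Σ_a ∫_{cell^N} |∂_{i,a}Ψ|²`. References: Schoenberg 1938;
Berg–Christensen–Ressel (1984) Ch. 3 §1–2; Stringari (1995) §2 (f-sum rule for the coherence).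
-/

noncomputable section

namespace Summit.AtomisticToContinuum.BoseEinsteinCondensation.Theorems

open Finset MeasureTheory InfDivGlue
open Literature.MathematicalPhysics.QuantumManyBody.BoseGas
open scoped ENNReal ComplexConjugate

namespace NegLevyMoment

variable {m : ℕ}

/-! ### Power series with non-negative coefficients preserve positive definiteness -/

/-- If every power `F^n` has a non-negative coefficient against the weights `w`, so does any
function `Φ = Σ_k a_k F^{e_k}` given pointwise by a power series with non-negative coefficients.
[folklore] -/
theorem sum_series_mul_nonneg_of_pow {ι : Type} [Fintype ι] (F w Φ : ι → ℝ) (a : ℕ → ℝ)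
    (e : ℕ → ℕ) (ha : ∀ k, 0 ≤ a k) (hΦ : ∀ j, HasSum (fun k => a k * F j ^ e k) (Φ j))
    (h : ∀ n, 0 ≤ ∑ j, F j ^ n * w j) : 0 ≤ ∑ j, Φ j * w j := by
  have hs : HasSum (fun k : ℕ => ∑ j, a k * F j ^ e k * w j) (∑ j, Φ j * w j) :=
    hasSum_sum fun j _ => HasSum.mul_right _ (hΦ j)
  refine hs.nonneg fun k => ?_
  have e1 : ∑ j, a k * F j ^ e k * w j = a k * ∑ j, F j ^ e k * w j := by
    rw [Finset.mul_sum]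
    exact Finset.sum_congr rfl fun j _ => by ring
  rw [e1]
  exact mul_nonneg (ha k) (h (e k))

/-- The odd part of the logarithmic series: `artanh s = (log(1+s) − log(1−s))/2 = Σ_k s^{2k+1}/(2k+1)`
for `|s| < 1`. [folklore] -/
theorem hasSum_artanh {s : ℝ} (hs : |s| < 1) :
    HasSum (fun k : ℕ => (1 / (2 * k + 1) : ℝ) * s ^ (2 * k + 1))
      ((Real.log (1 + s) - Real.log (1 - s)) / 2) := by
  have h := (Real.hasSum_log_sub_log_of_abs_lt_one hs).div_const 2
  refine h.congr_fun fun k => ?_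
  ring

/-- The even part of the logarithmic series: `−(log(1−s) + log(1+s))/2 = Σ_n [(n+1) even] s^{n+1}/(n+1)`
for `|s| < 1`, written with the non-negative coefficients `(1 + (−1)^{n+1})/(2(n+1))`. [folklore] -/
theorem hasSum_neg_half_log_one_sub_sq {s : ℝ} (hs : |s| < 1) :
    HasSum (fun n : ℕ => ((1 + (-1) ^ (n + 1)) / (2 * (n + 1)) : ℝ) * s ^ (n + 1))
      (-(Real.log (1 - s) + Real.log (1 + s)) / 2) := by
  have h1 := Real.hasSum_pow_div_log_of_abs_lt_one hs
  have hs' : |(-s)| < 1 := by rwa [abs_neg]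
  have h2 := Real.hasSum_pow_div_log_of_abs_lt_one hs'
  have h := (h1.add h2).div_const 2
  have hval : (-Real.log (1 - s) + -Real.log (1 - -s)) / 2 =
      -(Real.log (1 - s) + Real.log (1 + s)) / 2 := by
    rw [sub_neg_eq_add]; ring
  rw [hval] at h
  refine h.congr_fun fun n => ?_
  have hn : (n : ℝ) + 1 ≠ 0 := by positivity
  rw [neg_pow s (n + 1)]
  field_simp

/-- The coefficients `(1 + (−1)^{n+1})/(2(n+1))` are non-negative. [folklore] -/
theorem coeff_even_nonneg (n : ℕ) : (0 : ℝ) ≤ (1 + (-1) ^ (n + 1)) / (2 * (n + 1)) := by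
  refine div_nonneg ?_ (by positivity)
  rcases neg_one_pow_eq_or ℝ (n + 1) with h | h <;> rw [h] <;> norm_num

/-- Tangent bound for the convex even function `B(s) = −(log(1−s) + log(1+s))/2 = −½ log(1 − s²)`:
`B(x) − B(y) ≤ x(x − y)/(1 − x²)` whenever `|y| ≤ x < 1`
(`log t ≤ t − 1` with `t = (1 − y²)/(1 − x²)`). [folklore] -/
theorem B_sub_B_le {x y : ℝ} (hx1 : x < 1) (hy : |y| ≤ x) :
    -(Real.log (1 - x) + Real.log (1 + x)) / 2 - -(Real.log (1 - y) + Real.log (1 + y)) / 2 ≤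
      x / (1 - x ^ 2) * (x - y) := by
  have hx0 : 0 ≤ x := (abs_nonneg y).trans hy
  have hyx := abs_le.1 hy
  have hX : 0 < 1 - x ^ 2 := by nlinarith
  have hY : 0 < 1 - y ^ 2 := by nlinarith
  have hlx : Real.log (1 - x) + Real.log (1 + x) = Real.log (1 - x ^ 2) := by
    rw [← Real.log_mul (by linarith) (by linarith)]; ring_nf
  have hly : Real.log (1 - y) + Real.log (1 + y) = Real.log (1 - y ^ 2) := by
    rw [← Real.log_mul (by nlinarith) (by nlinarith)]; ring_nf
  rw [hlx, hly]
  have hlog : Real.log (1 - y ^ 2) - Real.log (1 - x ^ 2) ≤ (1 - y ^ 2) / (1 - x ^ 2) - 1 := by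
    rw [← Real.log_div hY.ne' hX.ne']
    exact Real.log_le_sub_one_of_pos (div_pos hY hX)
  have hq : (1 - y ^ 2) / (1 - x ^ 2) - 1 = (x + y) * (x - y) / (1 - x ^ 2) := by
    field_simp
    ring
  rw [hq] at hlog
  have hxy : (x + y) * (x - y) / (1 - x ^ 2) ≤ 2 * x * (x - y) / (1 - x ^ 2) := by
    apply div_le_div_of_nonneg_right _ hX.le
    nlinarith
  calc -Real.log (1 - x ^ 2) / 2 - -Real.log (1 - y ^ 2) / 2
      = (Real.log (1 - y ^ 2) - Real.log (1 - x ^ 2)) / 2 := by ring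
    _ ≤ (2 * x * (x - y) / (1 - x ^ 2)) / 2 := by linarith
    _ = x / (1 - x ^ 2) * (x - y) := by
        field_simp

/-! ### The pure statement on the finite torus `(ℤ/m)³` -/

/-- **Negative Lévy mass of a half-condensed positive-definite grid function.** Let `G` be an even
function on `(ℤ/m)³` (`m ≥ 2`) with non-negative cosine transform (Bochner form), `G(0) = 1`, and
zero-mode weight `g₀ = m⁻³ Σ_j G(j) > 1/2`. Then `G > 0` on the grid and the `λ`-weighted negative
part of the discrete Lévy weights `ν_q = m⁻³ Σ_j log G(j) cos(2π q·j/m)` of `log G` obeys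
`Σ_{q≠0} ν_q⁻ · Σ_a (1 − cos(2π q_a/m)) ≤ ((1 − g₀)/(2g₀ − 1)) · Σ_a ((1 − G(e_a)) + (1 − G(−e_a)))/2`.
[Schoenberg1938; BergChristensenRessel1984 Ch. 3 §1–2] -/
theorem negLevy_fsum_le [NeZero m] (hm : 2 ≤ m) (G : (Fin 3 → Fin m) → ℝ) (hev : ∀ j, G (-j) = G j)
    (h1 : G 0 = 1)
    (hpd : ∀ q : Fin 3 → Fin m, 0 ≤ ∑ j : Fin 3 → Fin m,
      G j * Real.cos (2 * Real.pi * (∑ k, ((q k : ℕ) : ℝ) * ((j k : ℕ) : ℝ)) / m))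
    (hhalf : (1 : ℝ) / 2 < (∑ j : Fin 3 → Fin m, G j) / (m : ℝ) ^ 3) :
    (∀ j, 0 < G j) ∧
    (∑ q : Fin 3 → Fin m with (∃ k, (q k : ℕ) ≠ 0),
        max (-((∑ j : Fin 3 → Fin m, Real.log (G j) *
          Real.cos (2 * Real.pi * (∑ k, ((q k : ℕ) : ℝ) * ((j k : ℕ) : ℝ)) / m)) / (m : ℝ) ^ 3)) 0 *
        (∑ a, (1 - Real.cos (2 * Real.pi * ((q a : ℕ) : ℝ) / m)))) ≤
      (1 - (∑ j : Fin 3 → Fin m, G j) / (m : ℝ) ^ 3) /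
          (2 * ((∑ j : Fin 3 → Fin m, G j) / (m : ℝ) ^ 3) - 1) *
        ∑ a : Fin 3, ((1 - G (Pi.single a 1)) + (1 - G (Pi.single a (-1)))) / 2 := by
  set θ : (Fin 3 → Fin m) → (Fin 3 → Fin m) → ℝ := fun q j =>
    2 * Real.pi * (∑ k, ((q k : ℕ) : ℝ) * ((j k : ℕ) : ℝ)) / m with hθ
  have hmpos : (0 : ℝ) < m := by exact_mod_cast (show 0 < m by omega)
  have hm3 : (0 : ℝ) < (m : ℝ) ^ 3 := by positivity
  set g : (Fin 3 → Fin m) → ℝ := fun q => (∑ j, G j * Real.cos (θ q j)) / (m : ℝ) ^ 3 with hgdef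
  have hg : ∀ q, 0 ≤ g q := fun q => div_nonneg (hpd q) hm3.le
  have hθq0 : ∀ q, θ q 0 = 0 := by intro q; simp [hθ]
  have hθ0j : ∀ j, θ 0 j = 0 := by intro j; simp [hθ]
  -- Fourier inversion and the total weight
  have hinv : ∀ j, G j = ∑ q, g q * Real.cos (θ q j) := stub_cosInversionEven m G hev
  have hsumg : ∑ q, g q = 1 := by rw [← h1]; exact sum_levyWeight G
  set g0 : ℝ := (∑ j, G j) / (m : ℝ) ^ 3 with hg0def
  have hg0 : g 0 = g0 := by
    simp only [hgdef, hg0def]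
    congr 1
    exact Finset.sum_congr rfl fun j _ => by rw [hθ0j, Real.cos_zero, mul_one]
  have hg0half : 1 / 2 < g0 := hhalf
  have hg0pos : 0 < g0 := by linarith
  have hrest : ∑ q ∈ Finset.univ.erase 0, g q = 1 - g0 := by
    rw [← hg0, ← hsumg, ← Finset.add_sum_erase _ _ (Finset.mem_univ (0 : Fin 3 → Fin m))]
    ring
  have hrest0 : 0 ≤ 1 - g0 := by rw [← hrest]; exact Finset.sum_nonneg fun q _ => hg q
  set x : ℝ := (1 - g0) / g0 with hxdef
  have hx0 : 0 ≤ x := div_nonneg hrest0 hg0pos.le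
  have hx1 : x < 1 := by rw [hxdef, div_lt_one hg0pos]; linarith
  -- the normalised fluctuation `u = (G - g₀)/g₀`, a non-negative cosine combination
  set c : (Fin 3 → Fin m) → ℝ := fun q => if q = 0 then 0 else g q / g0 with hcdef
  have hc : ∀ q, 0 ≤ c q := fun q => by
    simp only [hcdef]; split_ifs; exacts [le_rfl, div_nonneg (hg q) hg0pos.le]
  have hsumc : ∑ q, c q = x := by
    rw [← Finset.add_sum_erase _ _ (Finset.mem_univ (0 : Fin 3 → Fin m))]
    simp only [hcdef, if_true, zero_add]
    rw [Finset.sum_congr rfl fun q hq => if_neg (Finset.ne_of_mem_erase hq), ← Finset.sum_div,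
      hrest]
  set u : (Fin 3 → Fin m) → ℝ := fun j => ∑ q, c q * Real.cos (θ q j) with hudef
  have hGu : ∀ j, G j = g0 * (1 + u j) := by
    intro j
    rw [hinv j, ← Finset.add_sum_erase _ _ (Finset.mem_univ (0 : Fin 3 → Fin m)), hθ0j,
      Real.cos_zero, mul_one, hg0]
    simp only [hudef]
    rw [← Finset.add_sum_erase _ _ (Finset.mem_univ (0 : Fin 3 → Fin m))]
    simp only [hcdef, if_true, zero_mul, zero_add]
    rw [mul_add, mul_one, Finset.mul_sum]
    congr 1
    refine Finset.sum_congr rfl fun q hq => ?_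
    rw [if_neg (Finset.ne_of_mem_erase hq)]
    field_simp
  have hubound : ∀ j, |u j| ≤ x := by
    intro j
    calc |u j| ≤ ∑ q, |c q * Real.cos (θ q j)| := Finset.abs_sum_le_sum_abs _ _
      _ ≤ ∑ q, c q := Finset.sum_le_sum fun q _ => by
          rw [abs_mul, abs_of_nonneg (hc q)]
          exact (mul_le_mul_of_nonneg_left (Real.abs_cos_le_one _) (hc q)).trans (by rw [mul_one])
      _ = x := hsumc
  have hu0 : u 0 = x := by
    simp only [hudef]
    rw [← hsumc]
    exact Finset.sum_congr rfl fun q _ => by rw [hθq0, Real.cos_zero, mul_one]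
  have hult : ∀ j, |u j| < 1 := fun j => (hubound j).trans_lt hx1
  have hGpos : ∀ j, 0 < G j := by
    intro j
    rw [hGu j]
    have := (abs_le.1 (hubound j)).1
    exact mul_pos hg0pos (by linarith)
  refine ⟨hGpos, ?_⟩
  -- `log G = log g₀ + A(u) − B(u)` with `A`, `B` positive definite
  set A : (Fin 3 → Fin m) → ℝ := fun j => (Real.log (1 + u j) - Real.log (1 - u j)) / 2 with hAdef
  set B : (Fin 3 → Fin m) → ℝ := fun j => -(Real.log (1 - u j) + Real.log (1 + u j)) / 2 with hBdef
  have hlog : ∀ j, Real.log (G j) = Real.log g0 + A j - B j := by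
    intro j
    have h1u : 0 < 1 + u j := by linarith [(abs_lt.1 (hult j)).1]
    rw [hGu j, Real.log_mul hg0pos.ne' h1u.ne']
    simp only [hAdef, hBdef]
    ring
  -- `u` in integer-frequency form, and the sign of the coefficients of `A`, `B`
  have huZ : ∀ j, u j = ∑ q : Fin 3 → Fin m, c q *
      Real.cos (2 * Real.pi * (∑ k, ((j k : ℕ) : ℝ) * ((((q k : ℕ) : ℤ)) : ℝ)) / m) := by
    intro j
    simp only [hudef, hθ]
    refine Finset.sum_congr rfl fun q _ => ?_
    rw [Finset.sum_congr rfl fun k _ => mul_comm ((q k : ℕ) : ℝ) ((j k : ℕ) : ℝ)]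
    simp only [Int.cast_natCast]
  have hpow : ∀ (p : Fin 3 → Fin m) (n : ℕ), 0 ≤ ∑ j, u j ^ n * Real.cos (θ p j) := by
    intro p n
    have h := sum_cosComb_pow_mul_cos_nonneg (m := m)
      (fun (q : Fin 3 → Fin m) (k : Fin 3) => ((q k : ℕ) : ℤ)) c hc p n
    simpa only [← huZ] using h
  have hApos : ∀ p, 0 ≤ ∑ j, A j * Real.cos (θ p j) := fun p =>
    sum_series_mul_nonneg_of_pow u (fun j => Real.cos (θ p j)) A (fun k => 1 / (2 * k + 1))
      (fun k => 2 * k + 1) (fun k => by positivity) (fun j => hasSum_artanh (hult j)) (hpow p)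
  have hBpos : ∀ p, 0 ≤ ∑ j, B j * Real.cos (θ p j) := fun p =>
    sum_series_mul_nonneg_of_pow u (fun j => Real.cos (θ p j)) B
      (fun n => (1 + (-1) ^ (n + 1)) / (2 * (n + 1))) (fun n => n + 1) coeff_even_nonneg
      (fun j => hasSum_neg_half_log_one_sub_sq (hult j)) (hpow p)
  -- the Lévy weights off the origin: `ν_p = (â_p − b̂_p)/m³`, so `ν_p⁻ ≤ b̂_p/m³`
  have hν : ∀ p : Fin 3 → Fin m, (∃ k, (p k : ℕ) ≠ 0) →
      (∑ j, Real.log (G j) * Real.cos (θ p j)) / (m : ℝ) ^ 3 =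
        ((∑ j, A j * Real.cos (θ p j)) - ∑ j, B j * Real.cos (θ p j)) / (m : ℝ) ^ 3 := by
    intro p hp
    congr 1
    have h0 : ∑ j, Real.log g0 * Real.cos (θ p j) = 0 := by
      rw [← Finset.mul_sum]
      simp only [hθ]
      rw [stub_gridCharacterSum m p hp, mul_zero]
    rw [Finset.sum_congr rfl fun j _ => by rw [hlog j], ← Finset.sum_sub_distrib]
    have : ∀ j, (Real.log g0 + A j - B j) * Real.cos (θ p j) =
        Real.log g0 * Real.cos (θ p j) + (A j * Real.cos (θ p j) - B j * Real.cos (θ p j)) := by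
      intro j; ring
    rw [Finset.sum_congr rfl fun j _ => this j, Finset.sum_add_distrib, h0, zero_add]
  have hνneg : ∀ p : Fin 3 → Fin m, (∃ k, (p k : ℕ) ≠ 0) →
      max (-((∑ j, Real.log (G j) * Real.cos (θ p j)) / (m : ℝ) ^ 3)) 0 ≤
        (∑ j, B j * Real.cos (θ p j)) / (m : ℝ) ^ 3 := by
    intro p hp
    rw [hν p hp]
    refine max_le ?_ (div_nonneg (hBpos p) hm3.le)
    rw [← neg_div, neg_sub, sub_div]
    linarith [div_nonneg (hApos p) hm3.le]
  set lam : (Fin 3 → Fin m) → ℝ := fun q => ∑ a, (1 - Real.cos (2 * Real.pi * ((q a : ℕ) : ℝ) / m))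
    with hlam
  have hlam0 : ∀ q, 0 ≤ lam q := fun q => fsumWeight_nonneg q
  have hstep1 : (∑ q ∈ Finset.univ.filter (fun q : Fin 3 → Fin m => ∃ k, (q k : ℕ) ≠ 0),
      max (-((∑ j, Real.log (G j) * Real.cos (θ q j)) / (m : ℝ) ^ 3)) 0 * lam q) ≤
      ∑ q, (∑ j, B j * Real.cos (θ q j)) / (m : ℝ) ^ 3 * lam q := by
    calc (∑ q ∈ Finset.univ.filter (fun q : Fin 3 → Fin m => ∃ k, (q k : ℕ) ≠ 0),
          max (-((∑ j, Real.log (G j) * Real.cos (θ q j)) / (m : ℝ) ^ 3)) 0 * lam q)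
        ≤ ∑ q ∈ Finset.univ.filter (fun q : Fin 3 → Fin m => ∃ k, (q k : ℕ) ≠ 0),
          (∑ j, B j * Real.cos (θ q j)) / (m : ℝ) ^ 3 * lam q := by
          refine Finset.sum_le_sum fun q hq => ?_
          rw [Finset.mem_filter] at hq
          exact mul_le_mul_of_nonneg_right (hνneg q hq.2) (hlam0 q)
      _ ≤ ∑ q, (∑ j, B j * Real.cos (θ q j)) / (m : ℝ) ^ 3 * lam q :=
          Finset.sum_le_sum_of_subset_of_nonneg (Finset.filter_subset _ _) fun q _ _ =>
            mul_nonneg (div_nonneg (hBpos q) hm3.le) (hlam0 q)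
  have hfsum : ∑ q, (∑ j, B j * Real.cos (θ q j)) / (m : ℝ) ^ 3 * lam q =
      3 * B 0 - ∑ a : Fin 3, (B (Pi.single a 1) + B (Pi.single a (-1))) / 2 :=
    levyWeight_fsum hm B
  have hBx : ∀ y : Fin 3 → Fin m, B 0 - B y ≤ x / (1 - x ^ 2) * (x - u y) := by
    intro y
    simp only [hBdef]
    rw [hu0]
    exact B_sub_B_le hx1 (hubound y)
  have hxu : ∀ y : Fin 3 → Fin m, x - u y = (1 - G y) / g0 := by
    intro y
    rw [hGu y, hxdef]
    field_simp
    ring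
  have hK : x / (1 - x ^ 2) / g0 = (1 - g0) / (2 * g0 - 1) := by
    rw [hxdef]
    have h2 : 2 * g0 - 1 ≠ 0 := by linarith
    field_simp
    ring
  have hKnn : 0 ≤ x / (1 - x ^ 2) := div_nonneg hx0 (by nlinarith)
  calc (∑ q ∈ Finset.univ.filter (fun q : Fin 3 → Fin m => ∃ k, (q k : ℕ) ≠ 0),
        max (-((∑ j, Real.log (G j) * Real.cos (θ q j)) / (m : ℝ) ^ 3)) 0 * lam q)
      ≤ 3 * B 0 - ∑ a : Fin 3, (B (Pi.single a 1) + B (Pi.single a (-1))) / 2 := by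
        rw [← hfsum]; exact hstep1
    _ = ∑ a : Fin 3, ((B 0 - B (Pi.single a 1)) + (B 0 - B (Pi.single a (-1)))) / 2 := by
        rw [Fin.sum_univ_three, Fin.sum_univ_three]
        ring
    _ ≤ ∑ a : Fin 3, (x / (1 - x ^ 2) * (x - u (Pi.single a 1)) +
          x / (1 - x ^ 2) * (x - u (Pi.single a (-1)))) / 2 := by
        gcongr with a _
        · exact hBx _
        · exact hBx _
    _ = (1 - g0) / (2 * g0 - 1) * ∑ a : Fin 3, ((1 - G (Pi.single a 1)) + (1 - G (Pi.single a (-1)))) / 2 := by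
        rw [← hK, Finset.mul_sum]
        refine Finset.sum_congr rfl fun a _ => ?_
        rw [hxu, hxu]
        field_simp

end NegLevyMoment

open NegLevyMoment

/-- **The negative Lévy mass of a half-condensed coherence is controlled by the kinetic energy**
(crux vocabulary of `GridInfDivCoherence`). For a periodic trial state `Ψ`, a particle `i`, a grid size
`m ≥ 2` (`h = L/m`) and the translation coherence `G(r) = Re ∫_{cell^N} conj Ψ(update X i (xᵢ + r)) Ψ dX`:
if the grid average `g₀ = m⁻³ Σ_j G(hj)` exceeds `1/2`, then `G > 0` at the nodes and the discrete Lévy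
weights `ν_q = m⁻³ Σ_j log G(hj) cos(2π q·j/m)` satisfy
`Σ_{q≠0} ν_q⁻ Σ_a (1 − cos(2π q_a/m)) ≤ ((1 − g₀)/(2g₀ − 1)) · (h²/2) · Σ_a ∫_{cell^N} |∂_{i,a}Ψ|²` — no sign
hypothesis on `ν` (`negLevy_fsum_le` + `one_sub_coh_le`). [Schoenberg1938; BergChristensenRessel1984 Ch. 3 §1–2] -/
theorem negLevyMoment_coherence_le :
    ∀ (N : ℕ) (L : ℝ), 0 < L → ∀ (m : ℕ) [NeZero m], 2 ≤ m →
    ∀ (Ψ : PeriodicTrialState N L) (i : Fin N) (G : EuclideanSpace ℝ (Fin 3) → ℝ),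
    (∀ r, G r = (∫ X in cellN N L, conj (Ψ.ψ (Function.update X i (X i + r))) * Ψ.ψ X).re) →
    (1 : ℝ) / 2 < (∑ j : Fin 3 → Fin m, G (latticeVec (L / m) fun k => ((j k : ℕ) : ℤ))) / (m : ℝ) ^ 3 →
    (∀ a : Fin 3, (∫⁻ X in cellN N L,
      (‖fderiv ℝ Ψ.ψ X (Pi.single i (EuclideanSpace.single a (1 : ℝ)))‖₊ : ℝ≥0∞) ^ 2) ≠ ⊤) →
    (∀ j : Fin 3 → Fin m, 0 < G (latticeVec (L / m) fun k => ((j k : ℕ) : ℤ))) ∧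
    (∑ q : Fin 3 → Fin m with (∃ k, (q k : ℕ) ≠ 0),
        max (-((∑ j : Fin 3 → Fin m, Real.log (G (latticeVec (L / m) fun k => ((j k : ℕ) : ℤ))) *
          Real.cos (2 * Real.pi * (∑ k, ((q k : ℕ) : ℝ) * ((j k : ℕ) : ℝ)) / m)) / (m : ℝ) ^ 3)) 0 *
        (∑ a, (1 - Real.cos (2 * Real.pi * ((q a : ℕ) : ℝ) / m)))) ≤
      (1 - (∑ j : Fin 3 → Fin m, G (latticeVec (L / m) fun k => ((j k : ℕ) : ℤ))) / (m : ℝ) ^ 3) /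
          (2 * ((∑ j : Fin 3 → Fin m, G (latticeVec (L / m) fun k => ((j k : ℕ) : ℤ))) /
            (m : ℝ) ^ 3) - 1) *
        ((L / m) ^ 2 / 2 * ∑ a : Fin 3, (∫⁻ X in cellN N L,
          (‖fderiv ℝ Ψ.ψ X (Pi.single i (EuclideanSpace.single a (1 : ℝ)))‖₊ : ℝ≥0∞) ^ 2).toReal) := by
  intro N L hL m _ hm Ψ i G hGdef hhalf hfin
  set Gf : (Fin 3 → Fin m) → ℝ := fun j => G (latticeVec (L / m) fun k => ((j k : ℕ) : ℤ)) with hGf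
  have hm0 : 0 < m := by omega
  have hev : ∀ j, Gf (-j) = Gf j := by
    intro j
    simp only [hGf, hGdef]
    exact stub_cohGridEven N L hL m Ψ i j
  have h1 : Gf 0 = 1 := by
    simp only [hGf]
    have hz : (fun k => (((0 : Fin 3 → Fin m) k : ℕ) : ℤ)) = 0 := by funext k; simp
    rw [hz, latticeVec_zero, hGdef, coh_zero Ψ i]
  have hpd : ∀ q : Fin 3 → Fin m, 0 ≤ ∑ j : Fin 3 → Fin m,
      Gf j * Real.cos (2 * Real.pi * (∑ k, ((q k : ℕ) : ℝ) * ((j k : ℕ) : ℝ)) / m) := by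
    intro q
    cases N with
    | zero => exact i.elim0
    | succ n =>
      have h := BECInfDivCoherenceGridInfDiv.sum_re_cos_coherence_grid_nonneg hL hm0 Ψ i
        (fun k => ((q k : ℕ) : ℤ))
      simp only [Int.cast_natCast] at h
      simpa only [hGf, hGdef] using h
  obtain ⟨hpos, hmain⟩ := negLevy_fsum_le hm Gf hev h1 hpd hhalf
  refine ⟨hpos, hmain.trans ?_⟩
  -- the kinetic short-distance bound at the nodes `±e_a`
  have hcoef : 0 ≤ (1 - (∑ j, Gf j) / (m : ℝ) ^ 3) / (2 * ((∑ j, Gf j) / (m : ℝ) ^ 3) - 1) := by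
    have hle : (∑ j, Gf j) / (m : ℝ) ^ 3 ≤ 1 := by
      -- `g₀ ≤ Σ_q g_q = G(0) = 1`
      have hsum : ∑ q : Fin 3 → Fin m, (∑ j, Gf j *
          Real.cos (2 * Real.pi * (∑ k, ((q k : ℕ) : ℝ) * ((j k : ℕ) : ℝ)) / m)) / (m : ℝ) ^ 3 = 1 := by
        rw [← h1]; exact sum_levyWeight Gf
      have hm3 : (0 : ℝ) < (m : ℝ) ^ 3 := by positivity
      have h0 : (∑ j, Gf j) / (m : ℝ) ^ 3 = (∑ j, Gf j *
          Real.cos (2 * Real.pi * (∑ k, (((0 : Fin 3 → Fin m) k : ℕ) : ℝ) * ((j k : ℕ) : ℝ)) / m)) /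
            (m : ℝ) ^ 3 := by
        congr 1
        exact Finset.sum_congr rfl fun j _ => by simp
      rw [h0, ← hsum]
      exact Finset.single_le_sum (f := fun q : Fin 3 → Fin m => (∑ j, Gf j *
          Real.cos (2 * Real.pi * (∑ k, ((q k : ℕ) : ℝ) * ((j k : ℕ) : ℝ)) / m)) / (m : ℝ) ^ 3)
        (fun q _ => div_nonneg (hpd q) hm3.le) (Finset.mem_univ 0)
    exact div_nonneg (by linarith) (by linarith)
  refine mul_le_mul_of_nonneg_left ?_ hcoef
  rw [Finset.mul_sum, ← Finset.sum_div]
  have hsum3 : (∑ a : Fin 3, ((1 - Gf (Pi.single a 1)) + (1 - Gf (Pi.single a (-1))))) / 2 =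
      ∑ a : Fin 3, (1 - Gf (Pi.single a 1)) := by
    have : ∀ a : Fin 3, Gf (Pi.single a (-1)) = Gf (Pi.single a 1) := by
      intro a
      rw [← hev (Pi.single a 1), Pi.single_neg]
    rw [Finset.sum_congr rfl fun a _ => by rw [this a], Finset.sum_div]
    exact Finset.sum_congr rfl fun a _ => by ring
  rw [hsum3]
  refine Finset.sum_le_sum fun a _ => ?_
  have hnode : Gf (Pi.single a 1) = G ((L / m) • EuclideanSpace.single a (1 : ℝ)) := by
    simp only [hGf]
    rw [latticeVec_single_one hm]
  rw [hnode, hGdef]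
  exact one_sub_coh_le hL Ψ i a (L / m) (hfin a)

end Summit.AtomisticToContinuum.BoseEinsteinCondensation.Theorems

end
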